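import Summits.CriticalPhenomena.CardyFormulaZ2.Theses.CardySelfRefinement
import Literature.Probability.RandomPlanarGeometry.SLEUniquenessInLaw

/-!
# Sketch (crux-ideate, ideator 3, gen 2) — crux `SubseqUpgrade` (stmt-CriticalPhenomena-10279)

Independent re-verification, against the live tree (route file rev 8, 2026-08-16), of the line
`uniqueness-pin-subsequence`: the crux is a theorem.  First lemma
`convergesInLawToSLE_of_subseq_limits` = the model-free subsequence principle with the WEAKEST
hypotheses the lever needs (per-domain limit law, reindexing only `Tendsto φ atTop atTop`), then
the crux `subseqUpgrade_holds` by specialisation.  Lever: `IsSLELaw.unique'` (uniqueness in law of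
chordal SLE_κ in a Dobrushin domain, tree theorem) pins every subsequential limit to the law of ONE
SLE curve handed over by the hypothesis itself; `Filter.tendsto_of_subseq_tendsto` on the countably
generated filter `𝓝[>] 0` concludes, test function by test function.
-/

open Filter Topology MeasureTheory
open scoped NNReal BoundedContinuousFunction

namespace Summit.CriticalPhenomena.CardyFormulaZ2.Cruxes.SubseqUpgrade.SketchIdeator3G2

open Literature.Probability.RandomPlanarGeometry

/-- **First lemma (model-free subsequence principle for convergence in law to chordal SLE_κ).**
Eventual a.e.-measurability of the random curve classes `Y δ` plus: along every everywhere-positive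
null sequence of meshes some reindexing `φ → ∞` makes the laws converge, on bounded continuous test
functions, to SOME chordal SLE_κ law of `(D; a, b)` — imply `ConvergesInLawToSLE κ D Y P`.
Billingsley (1999), Thm. 2.6; Lawler (2005), §6.1/§6.3. -/
theorem convergesInLawToSLE_of_subseq_limits {κ : ℝ≥0} {D : DobrushinDomain}
    {Ωδ : ℝ → Type*} [∀ δ, MeasurableSpace (Ωδ δ)] {Y : ∀ δ, Ωδ δ → CurveClass ℂ}
    {P : ∀ δ, Measure (Ωδ δ)}
    (hY : ∀ᶠ δ in 𝓝[>] (0 : ℝ), AEMeasurable (Y δ) (P δ))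
    (h : ∀ s : ℕ → ℝ, (∀ n, 0 < s n) → Tendsto s atTop (𝓝 0) →
      ∃ φ : ℕ → ℕ, Tendsto φ atTop atTop ∧ ∃ μ : Measure (CurveClass ℂ), IsSLELaw κ D μ ∧
        ∀ f : CurveClass ℂ →ᵇ ℝ,
          Tendsto (fun n ↦ ∫ ω, f (Y (s (φ n)) ω) ∂P (s (φ n))) atTop (𝓝 (∫ x, f x ∂μ))) :
    ConvergesInLawToSLE κ D Y P := by
  -- the witness curve: read off the limit along the harmonic mesh sequence
  obtain ⟨-, -, -, ⟨Γ, hΓ, -⟩, -⟩ :=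
    h (fun n ↦ 1 / ((n : ℝ) + 1)) (fun n ↦ Nat.one_div_pos_of_nat)
      tendsto_one_div_add_atTop_nhds_zero_nat
  refine ⟨Γ, hΓ, hY, fun f ↦ tendsto_of_subseq_tendsto fun s hs ↦ ?_⟩
  -- an eventually-positive sequence: shift the index past the last non-positive term
  obtain ⟨N, hN⟩ := eventually_atTop.1 (tendsto_nhdsWithin_iff.1 hs).2
  obtain ⟨φ, -, μ, hμ, hlim⟩ := h (fun n ↦ s (n + N)) (fun n ↦ hN _ (N.le_add_left n))
    ((tendsto_nhds_of_tendsto_nhdsWithin hs).comp (tendsto_add_atTop_nat N))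
  refine ⟨fun n ↦ φ n + N, ?_⟩
  -- the pin: the limit law is THE chordal SLE_κ law of `D`, the law of `Γ`
  have hl := hlim f
  rwa [hμ.unique' hΓ.isSLELaw_map,
    integral_map hΓ.aemeasurable f.continuous.aestronglyMeasurable] at hl

open Summit.CriticalPhenomena.CardyFormulaZ2.Theses.CardySelfRefinement in
/-- **The crux** `CardySelfRefinement.SubseqUpgrade` (stmt-CriticalPhenomena-10279) holds: the
route's hypothesis (one strictly increasing subsequence and one chordal family for all `(D, E)`)
over-delivers the per-`(D, E)` data of the first lemma. -/
theorem subseqUpgrade_holds : SubseqUpgrade := by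
  rintro ⟨hmeas, hsub⟩ D E hE
  refine convergesInLawToSLE_of_subseq_limits (hmeas D E hE) fun s hs hs0 ↦ ?_
  obtain ⟨φ, hφ, Pfam, hP, hlim⟩ := hsub s hs hs0
  exact ⟨φ, hφ.tendsto_atTop, Pfam D, hP D, hlim D E hE⟩

end Summit.CriticalPhenomena.CardyFormulaZ2.Cruxes.SubseqUpgrade.SketchIdeator3G2
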